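import Summits.BirchSwinnertonDyer.BirchSwinnertonDyer.Theorems.Rank2Observatory2DescVCover
import Summits.BirchSwinnertonDyer.BirchSwinnertonDyer.Theorems.Rank2Observatory2DescKillCheck
import HarnessLib

/-!
# BirchSwinnertonDyer — rank ≥ 2 observatory: KERNEL-2DESC kill layer (B), from `(x − θ)·z ∈ K²`
# to a primitive zero of the two quadrics, and the rank bound with killed classes

HONEST FRAMING: per-curve certified theorems and census instruments; no claim on BSD in rank ≥ 2.

Number-field half of the KERNEL-2DESC v1.3a kill layer (design `b2b-bsdr2-cert-3/KERNEL-2DESC.md`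
§11; integer half `Rank2Observatory2DescKillCheck`). For the census rows with trivial rational
`2`-torsion whose norm / sign sieve admits `8` classes (`dim V_ℝ = 3`) the count of
`Rank2Observatory2DescVCover` only gives `rank ≤ 3`; one class `z` must be KILLED, i.e. shown not to
be `(x − θ)·K×²` for any rational point. This file proves

* `not_isSquare_of_killCheck` — in the cubic field `K = ℚ(α)`, `α³ + aα² + bα + c = 0`
  (`F` irreducible, `[K:ℚ] = 3`): if the residue search `killCheck p a b c z t₁ t₂ fuel` succeeds,
  then `(x − θ)·z` is a square for NO `x ∈ ℚ` (`θ = t₀ + t₁α + t₂α²`, `z = z₀ + z₁α + z₂α² ≠ 0`).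
  Proof: `x − θ = z ρ²`, write `ρ = (r₀ + r₁α + r₂α²)/n` with `n ≥ 1` MINIMAL (so `(r, n)` is
  primitive at `p`), expand `n²(x − θ) = z·(r₀ + r₁α + r₂α²)²` on the power basis (`ev_zsq`) and
  compare the `α`, `α²` coordinates (`powIndep_algebraMap`): `killQ (r, n) = 0`, contradicting
  `killCheck_sound`;
* `mordellWeilRank_le_of_sqClass_cover_lt`, `mordellWeilRank_le_of_coverSet_lt` — the cover theorems
  of `Rank2Observatory2DescVCover` with the sharper count `#admissible < 2^(s'+1) ⇒ rank ≤ s'`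
  (from `2^rank ≤ #cover`), so that `7` surviving classes give `rank ≤ 2`;
* `admKill`, `admKill_of`, `admKill_empty` — the Boolean sieve "admissible and not the killed pair".

Sorry-free; axioms `propext`, `Classical.choice`, `Quot.sound`. Mathematics: Cassels, *Lectures on
Elliptic Curves* (1991) §15; D. Simon, LMS J. Comput. Math. 5 (2002) §2 (local solubility of the
quadrics attached to a class); Cremona, *Algorithms* (1997) §3.6.
[cite: Cassels1991LecturesEllipticCurves, §15] [cite: CremonaAlgorithms1997, §3.6]
-/

-- single-conjunct summit: `Summit.BirchSwinnertonDyer.BirchSwinnertonDyer.…` repeats the name by design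
set_option linter.dupNamespace false

noncomputable section

open scoped Classical NumberField

open Literature.NumberTheory.EllipticCurves Literature.NumberTheory.NumberFields
open WeierstrassCurve WeierstrassCurve.Affine WeierstrassCurve.Affine.Point
open Polynomial

namespace Summit.BirchSwinnertonDyer.BirchSwinnertonDyer.Rank2Observatory.TwoDescCubic

open TwoDescKill

/-! ## The rank bound with a strict count -/

section RankBound

variable {F K : Type*} [Field F] [NumberField F] [Field K] [CharZero K]

/-- Rank bound of the cubic-field descent, strict-count form: if the classes `(φ x − e)·K×²` of all
`F`-points lie in a finite set `S ∋ 1` with `#S < 2^(s+1)`, then `rank E(F) ≤ s` (since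
`2^rank ≤ #S`). [cite: Cassels1991LecturesEllipticCurves, §15] -/
theorem mordellWeilRank_le_of_sqClass_cover_lt (W : WeierstrassCurve F) [W.IsElliptic] (φ : F →+* K)
    {e : K} (ha₁ : W.a₁ = 0) (ha₃ : W.a₃ = 0)
    (hroot : e ^ 3 + φ W.a₂ * e ^ 2 + φ W.a₄ * e + φ W.a₆ = 0)
    (hlin : ∀ c₀ c₁ c₂ : F, φ c₂ * e ^ 2 + φ c₁ * e + φ c₀ = 0 → c₀ = 0 ∧ c₁ = 0 ∧ c₂ = 0)
    (hspan : ∀ z : K, ∃ c₀ c₁ c₂ : F, z = φ c₂ * e ^ 2 + φ c₁ * e + φ c₀)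
    (S : Finset (SqUnits K)) (h1 : (1 : SqUnits K) ∈ S)
    (hS : ∀ x y : F, W.toAffine.Nonsingular x y → sqClass (φ x - e) ∈ S)
    {s : ℕ} (hcard : S.card < 2 ^ (s + 1)) : W.mordellWeilRank ≤ s := by
  haveI : Module.Finite ℤ W.toAffine.Point := W.module_finite_point_holds
  set ψ := muHom W.toAffine φ e (two_division_cubic_of_a ha₁ ha₃ hroot) (ne_of_powIndep hlin)
    with hψ
  have hker : ∀ P : W.toAffine.Point, ψ P = 0 → ∃ Q : W.toAffine.Point, P = 2 • Q :=
    fun P hP => muHom_ker_le ha₁ ha₃ hroot hlin hspan P hP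
  have hS' : ∀ P : W.toAffine.Point, ψ P ∈ S.map (Equiv.toEmbedding Additive.ofMul) := by
    intro P
    rw [Finset.mem_map_equiv]
    rcases P with _ | @⟨x, y, h⟩
    · show Additive.toMul (Additive.ofMul (muMap W.toAffine φ e 0)) ∈ S
      rw [muMap_zero]
      exact h1
    · simpa only [hψ, muHom_apply, muMap_some, Additive.ofMul_symm_eq, toMul_ofMul] using hS x y h
  have hb := two_pow_finrank_le_card ψ hker (S.map (Equiv.toEmbedding Additive.ofMul)) hS'
  rw [Finset.card_map] at hb
  rw [WeierstrassCurve.mordellWeilRank]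
  exact Nat.lt_succ_iff.mp ((pow_lt_pow_iff_right₀ (by norm_num : (1 : ℕ) < 2)).mp (hb.trans_lt hcard))

end RankBound

section VCover

open IsDedekindDomain NumberField Module

variable {K : Type*} [Field K] [NumberField K] {m s : ℕ}

/-- **Rank bound of the cubic-field 2-descent from certificates, strict-count form**: as
`mordellWeilRank_le_of_coverSet`, with `#admissible pairs < 2^(s'+1) ⇒ rank E(ℚ) ≤ s'`.
[cite: Cassels1991LecturesEllipticCurves, §15] -/
theorem mordellWeilRank_le_of_coverSet_lt [IsPrincipalIdealRing (𝓞 K)] {A B C : ℤ}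
    (E : WeierstrassCurve ℚ) [E.IsElliptic] (ha₁ : E.a₁ = 0) (ha₂ : E.a₂ = A) (ha₃ : E.a₃ = 0)
    (ha₄ : E.a₄ = B) (ha₆ : E.a₆ = C) (hirr : Irreducible (MonicCubic.polyQ A B C)) {θ : 𝓞 K}
    (hθ : aeval (algebraMap (𝓞 K) K θ) (MonicCubic.poly A B C) = 0) (h3 : finrank ℚ K = 3)
    {G : Fin s → 𝓞 K} (hG : Function.Injective G) (hG0 : ∀ j, G j ≠ 0)
    (hD : ∀ q : 𝓞 K, Prime q → q ∣ 3 * θ ^ 2 + 2 * A * θ + B → ∃ j, Associated q (G j))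
    {Wu : Fin m → (𝓞 K)ˣ}
    (hW : ∀ u : (𝓞 K)ˣ, ∃ T : Finset (Fin m), IsSquare (u * ∏ i ∈ T, Wu i))
    {adm : Finset (Fin m) → Finset (Fin s) → Bool} (h0 : adm ∅ ∅ = true)
    (hadm : ∀ x y : ℚ, y ^ 2 = x ^ 3 + A * x ^ 2 + B * x + C →
      ∀ (T : Finset (Fin m)) (U : Finset (Fin s)),
        IsSquare ((algebraMap ℚ K x - algebraMap (𝓞 K) K θ) *
          (∏ i ∈ T, algebraMap (𝓞 K) K (Wu i)) * ∏ j ∈ U, algebraMap (𝓞 K) K (G j)) →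
        adm T U = true)
    {s' : ℕ} (hcard : ((Finset.univ ×ˢ Finset.univ).filter
      (fun p : Finset (Fin m) × Finset (Fin s) => adm p.1 p.2 = true)).card < 2 ^ (s' + 1)) :
    E.mordellWeilRank ≤ s' := by
  have hrootK := MonicCubic.theta_rel hθ
  have hF : θ ^ 3 + A * θ ^ 2 + B * θ + C = 0 := by
    apply RingOfIntegers.coe_injective
    simpa only [map_add, map_mul, map_pow, map_intCast, _root_.map_zero] using hrootK
  have hroot : (algebraMap (𝓞 K) K θ) ^ 3 + algebraMap ℚ K E.a₂ * (algebraMap (𝓞 K) K θ) ^ 2 +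
      algebraMap ℚ K E.a₄ * algebraMap (𝓞 K) K θ + algebraMap ℚ K E.a₆ = 0 := by
    rw [ha₂, ha₄, ha₆]
    simpa only [map_intCast] using hrootK
  have hlin := powIndep_algebraMap hirr hθ h3
  have hspan := exists_coords hirr hθ h3
  have hθQ : ∀ q : ℚ, algebraMap ℚ K q ≠ algebraMap (𝓞 K) K θ := ne_of_powIndep hlin
  refine mordellWeilRank_le_of_sqClass_cover_lt E (algebraMap ℚ K) ha₁ ha₃ hroot hlin hspan
    (coverSet Wu G adm) (one_mem_coverSet Wu G h0) ?_ ((card_coverSet_le Wu G adm).trans_lt hcard)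
  intro x y hxy
  have hE : y ^ 2 = x ^ 3 + A * x ^ 2 + B * x + C := by
    have h := hxy.left
    rw [WeierstrassCurve.Affine.equation_iff] at h
    have e₁ : E.toAffine.a₁ = 0 := ha₁
    have e₂ : E.toAffine.a₂ = A := ha₂
    have e₃ : E.toAffine.a₃ = 0 := ha₃
    have e₄ : E.toAffine.a₄ = B := ha₄
    have e₆ : E.toAffine.a₆ = C := ha₆
    rw [e₁, e₂, e₃, e₄, e₆] at h
    linear_combination h
  exact sqClass_mem_coverSet hF hθQ hG hG0 hD hW hadm hE

/-- The sieve "admissible and not the killed pair `(T₀, U₀)`". [folklore] -/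
def admKill (adm : Finset (Fin m) → Finset (Fin s) → Bool) (T₀ : Finset (Fin m))
    (U₀ : Finset (Fin s)) (T : Finset (Fin m)) (U : Finset (Fin s)) : Bool :=
  adm T U && !(decide (T = T₀) && decide (U = U₀))

omit [NumberField K] in
/-- `admKill` accepts an admissible pair other than the killed one. [folklore] -/
theorem admKill_of {adm : Finset (Fin m) → Finset (Fin s) → Bool} {T₀ T : Finset (Fin m)}
    {U₀ U : Finset (Fin s)} (hadm : adm T U = true) (hne : ¬ (T = T₀ ∧ U = U₀)) :
    admKill adm T₀ U₀ T U = true := by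
  simp only [admKill, hadm, Bool.true_and, Bool.not_eq_true', Bool.and_eq_false_iff,
    decide_eq_false_iff_not]
  tauto

omit [NumberField K] in
/-- The empty pair passes `admKill` when it is admissible and not the killed pair. [folklore] -/
theorem admKill_empty {adm : Finset (Fin m) → Finset (Fin s) → Bool} {T₀ : Finset (Fin m)}
    {U₀ : Finset (Fin s)} (h0 : adm ∅ ∅ = true) (hne : ¬ (∅ = T₀ ∧ ∅ = U₀)) :
    admKill adm T₀ U₀ ∅ ∅ = true :=
  admKill_of h0 hne

end VCover

/-! ## Kill soundness in the cubic field -/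

section Kill

open Module

variable {K : Type*} [Field K] [NumberField K] {a b c : ℤ} {α : K}

/-- Clearing denominators of three rationals at once. [folklore] -/
theorem exists_common_den (c₀ c₁ c₂ : ℚ) : ∃ n : ℕ, 0 < n ∧ ∃ r₀ r₁ r₂ : ℤ,
    (n : ℚ) * c₀ = r₀ ∧ (n : ℚ) * c₁ = r₁ ∧ (n : ℚ) * c₂ = r₂ := by
  refine ⟨c₀.den * c₁.den * c₂.den, by positivity, c₀.num * c₁.den * c₂.den,
    c₁.num * c₀.den * c₂.den, c₂.num * c₀.den * c₁.den, ?_, ?_, ?_⟩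
  · push_cast; linear_combination ((c₁.den : ℚ) * c₂.den) * Rat.mul_den_eq_num c₀
  · push_cast; linear_combination ((c₀.den : ℚ) * c₂.den) * Rat.mul_den_eq_num c₁
  · push_cast; linear_combination ((c₀.den : ℚ) * c₁.den) * Rat.mul_den_eq_num c₂

/-- **Kill soundness.** `K = ℚ(α)` a cubic field, `α³ + aα² + bα + c = 0`, `F = X³ + aX² + bX + c`
irreducible; `θ = t₀ + t₁α + t₂α²`, `z = z₀ + z₁α + z₂α² ≠ 0`. If the residue search
`killCheck p a b c z t₁ t₂ fuel` succeeds at a prime `p`, then `(x − θ)·z` is not a square in `K`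
for any `x ∈ ℚ`. [cite: Cassels1991LecturesEllipticCurves, §15] -/
theorem not_isSquare_of_killCheck (hirr : Irreducible (MonicCubic.polyQ a b c))
    (hα : aeval α (MonicCubic.poly a b c) = 0) (h3 : finrank ℚ K = 3)
    {p : ℕ} (hp : p.Prime) {z₀ z₁ z₂ : ℤ} (t₀ : ℤ) {t₁ t₂ : ℤ} {fuel : ℕ}
    (hkill : killCheck p a b c (z₀, z₁, z₂) t₁ t₂ fuel = true)
    (hz : (z₀, z₁, z₂) ≠ ((0 : ℤ), (0 : ℤ), (0 : ℤ))) (x : ℚ) :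
    ¬ IsSquare ((algebraMap ℚ K x - ((t₀ : K) + (t₁ : K) * α + (t₂ : K) * α ^ 2)) *
        ((z₀ : K) + (z₁ : K) * α + (z₂ : K) * α ^ 2)) := by
  classical
  rintro ⟨w, hw⟩
  have hrel := MonicCubic.theta_rel hα
  have hlin := powIndep_algebraMap hirr hα h3
  set Θ : K := (t₀ : K) + (t₁ : K) * α + (t₂ : K) * α ^ 2 with hΘ
  set Z : K := (z₀ : K) + (z₁ : K) * α + (z₂ : K) * α ^ 2 with hZdef
  -- `z ≠ 0` in `K`
  have hZ : Z ≠ 0 := by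
    intro h0
    have e : algebraMap ℚ K (z₂ : ℚ) * α ^ 2 + algebraMap ℚ K (z₁ : ℚ) * α +
        algebraMap ℚ K (z₀ : ℚ) = 0 := by
      simp only [map_intCast]; linear_combination h0
    obtain ⟨e₀, e₁, e₂⟩ := hlin _ _ _ e
    exact hz (Prod.ext (by exact_mod_cast e₀) (Prod.ext (by exact_mod_cast e₁) (by exact_mod_cast e₂)))
  -- `x − θ = z ρ²`
  set ρ : K := w / Z with hρ
  have hZρ : Z * ρ ^ 2 = algebraMap ℚ K x - Θ := by
    have h1 : Z * ρ ^ 2 = (w * w) / Z := by rw [hρ]; field_simp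
    rw [h1, ← hw]; field_simp
  -- `ρ = (r₀ + r₁α + r₂α²)/n` with `n ≥ 1` minimal
  obtain ⟨c₀, c₁, c₂, hc⟩ := exists_coords hirr hα h3 ρ
  have hP : ∃ n : ℕ, 0 < n ∧ ∃ r₀ r₁ r₂ : ℤ,
      (n : K) * ρ = (r₀ : K) + (r₁ : K) * α + (r₂ : K) * α ^ 2 := by
    obtain ⟨n, hn, r₀, r₁, r₂, f₀, f₁, f₂⟩ := exists_common_den c₀ c₁ c₂
    refine ⟨n, hn, r₀, r₁, r₂, ?_⟩
    have g₀ : (n : K) * algebraMap ℚ K c₀ = (r₀ : K) := by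
      rw [← map_natCast (algebraMap ℚ K), ← map_mul, f₀, map_intCast]
    have g₁ : (n : K) * algebraMap ℚ K c₁ = (r₁ : K) := by
      rw [← map_natCast (algebraMap ℚ K), ← map_mul, f₁, map_intCast]
    have g₂ : (n : K) * algebraMap ℚ K c₂ = (r₂ : K) := by
      rw [← map_natCast (algebraMap ℚ K), ← map_mul, f₂, map_intCast]
    rw [hc]
    linear_combination g₀ + g₁ * α + g₂ * α ^ 2
  obtain ⟨hn0, r₀, r₁, r₂, hr⟩ := Nat.find_spec hP
  set n : ℕ := Nat.find hP with hn
  -- primitivity at `p` by minimality of `n`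
  have hprim : ¬ ((p : ℤ) ∣ r₀ ∧ (p : ℤ) ∣ r₁ ∧ (p : ℤ) ∣ r₂ ∧ (p : ℤ) ∣ ((n : ℕ) : ℤ)) := by
    rintro ⟨⟨s₀, hs₀⟩, ⟨s₁, hs₁⟩, ⟨s₂, hs₂⟩, ⟨k, hk⟩⟩
    have hp0 : (0 : ℤ) < p := by exact_mod_cast hp.pos
    have hk0 : 0 < k := by
      have h1 : (0 : ℤ) < p * k := by rw [← hk]; exact_mod_cast hn0
      exact pos_of_mul_pos_right h1 hp0.le
    have hkn : k.toNat < n := by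
      have e1 : (k.toNat : ℤ) = k := Int.toNat_of_nonneg hk0.le
      have hp2 : (2 : ℤ) ≤ p := by exact_mod_cast hp.two_le
      have h2 : (k.toNat : ℤ) < ((n : ℕ) : ℤ) := by rw [e1, hk]; nlinarith
      exact_mod_cast h2
    refine Nat.find_min hP hkn ⟨by omega, s₀, s₁, s₂, ?_⟩
    have hpK : (p : K) ≠ 0 := by exact_mod_cast hp.ne_zero
    have hnK : ((n : ℕ) : K) = (p : K) * (k.toNat : K) := by
      have e2 : ((n : ℕ) : ℤ) = p * (k.toNat : ℤ) := by rw [Int.toNat_of_nonneg hk0.le]; exact hk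
      exact_mod_cast e2
    apply mul_left_cancel₀ hpK
    rw [← mul_assoc, ← hnK, hr, hs₀, hs₁, hs₂]
    push_cast
    ring
  -- the coordinate identity `z·(r₀ + r₁α + r₂α²)² = n²(x − θ)` on the power basis
  have hcast := map_zsq (Int.castRingHom K) a b c (z₀, z₁, z₂) (r₀, r₁, r₂)
  simp only [eq_intCast] at hcast
  have hev : ev α ((((zsq a b c (z₀, z₁, z₂) (r₀, r₁, r₂)).1 : ℤ) : K),
      (((zsq a b c (z₀, z₁, z₂) (r₀, r₁, r₂)).2.1 : ℤ) : K),
      (((zsq a b c (z₀, z₁, z₂) (r₀, r₁, r₂)).2.2 : ℤ) : K)) =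
      ((n : ℕ) : K) ^ 2 * (algebraMap ℚ K x - Θ) := by
    rw [hcast, ev_zsq hrel, ← hZρ]
    have e3 : ev α ((r₀ : K), (r₁ : K), (r₂ : K)) = (n : K) * ρ := by
      rw [hr]; simp only [ev]
    rw [e3, hZdef]
    simp only [ev]
    ring
  -- compare coordinates
  have hcomb : algebraMap ℚ K (((zsq a b c (z₀, z₁, z₂) (r₀, r₁, r₂)).2.2 : ℚ) + t₂ * (n : ℚ) ^ 2) * α ^ 2 +
      algebraMap ℚ K (((zsq a b c (z₀, z₁, z₂) (r₀, r₁, r₂)).2.1 : ℚ) + t₁ * (n : ℚ) ^ 2) * α +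
      algebraMap ℚ K (((zsq a b c (z₀, z₁, z₂) (r₀, r₁, r₂)).1 : ℚ) + (t₀ - x) * (n : ℚ) ^ 2) = 0 := by
    simp only [map_add, map_mul, map_sub, map_pow, map_intCast, map_natCast]
    simp only [ev] at hev
    linear_combination hev
  obtain ⟨-, e₁, e₂⟩ := hlin _ _ _ hcomb
  have hq : killQ a b c (z₀, z₁, z₂) t₁ t₂ (r₀, r₁, r₂, ((n : ℕ) : ℤ)) = 0 := by
    refine Prod.ext ?_ ?_
    · have : ((zsq a b c (z₀, z₁, z₂) (r₀, r₁, r₂)).2.1 : ℤ) + t₁ * ((n : ℕ) : ℤ) ^ 2 = 0 := by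
        exact_mod_cast e₁
      simpa [killQ] using this
    · have : ((zsq a b c (z₀, z₁, z₂) (r₀, r₁, r₂)).2.2 : ℤ) + t₂ * ((n : ℕ) : ℤ) ^ 2 = 0 := by
        exact_mod_cast e₂
      simpa [killQ] using this
  exact killCheck_sound hp hkill (r₀, r₁, r₂, ((n : ℕ) : ℤ)) hprim hq

end Kill

end Summit.BirchSwinnertonDyer.BirchSwinnertonDyer.Rank2Observatory.TwoDescCubic

end
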